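import Summits.AtomisticToContinuum.HydrodynamicLimit.Theorems.InformationPercolationEngineChaosClosesEulerStressIsotropyD
import Summits.AtomisticToContinuum.HydrodynamicLimit.Theorems.InformationPercolationEngineChaosClosesEulerMaxwellianMoments
import Summits.AtomisticToContinuum.HydrodynamicLimit.Theorems.JParityClosureKineticEnergyTailsApriori
import Literature.Analysis.FluidPDE.BoltzmannEquation
import HarnessLib

/-!
# Pointwise local equilibrium from the empirical H-theorem (crux `ChaosClosesEuler`,
# stmt-AtomisticToContinuum-15141, line `empirical-h-theorem`, stub `stub_localEquilibriumFromDissipation`)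
# — helper A: the smoothed log-density of a cone law

WHAT. The objects of the entropic mark of the line `empirical-h-theorem`, for ONE configuration `w` of `N + 1`
particles, one centre `x` and the cone scale `r` (named definitions, DEFINITIONALLY the `let`s of the skeleton
`Cruxes/ChaosClosesEuler/Lines/empirical_h_theorem.lean` with the cone law inserted):

* `phiD δ` — the velocity mollifier `φ_δ = M_{1,δ²,0}`, a Gaussian of variance `δ²` (`phiD_eq`: `φ_δ(v − u)` is the
  density of `gaussMeasure v δ²`), with `0 ≤ φ_δ ≤ phiMax δ`, unit mass and second moment `‖v‖² + 3δ²`;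
* `yK K v = e^{−K}(1+‖v‖²)⁻²` — the floor, `ellK K v y` — the logarithm floored `C¹`-smoothly at `yK K v`, jointly
  continuous (`ellK_eq`: `log (max y y₀) + min 0 ((y − y₀)/y₀)`), with `|ℓ_K(v, y)| ≤ |K| + 1 + log C + 2‖v‖²` for
  `0 ≤ y ≤ C`, `1 ≤ C`;
* `gC r δ w x` — the `δ`-mollified `x`-cone velocity law `g_x(v) = ∫ b_r(q.1, x) φ_δ(v − q.2) dμ_w`
  (`0 ≤ g ≤ phiMax δ · ρ_r(x)`, jointly continuous);
* `LamC r δ K w x` — the doubly mollified floored log-density `Λ̃_x = φ_δ ∗ ℓ_K(·, g_x(·))`, jointly measurable, with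
  the LOG-GROWTH bound `|Λ̃_x(v)| ≤ ALam K δ ρ̄ + 2‖v‖²` whenever `ρ_r(x) ≤ ρ̄` (the constant does NOT depend on `r`
  or `N`: the density weight of the statement vanishes where `ρ_r` is large);
* `cutL`, `predF`, `dissF`, `PredC`, `DissC` — the pair-energy cut, the cut Enskog prediction `𝒫` of the statement and
  the cut dissipation `D` of `DissipationRigidity`, as functionals of an abstract `Λ : V3 → ℝ` and of the cone law.

References: C. Cercignani, R. Illner, M. Pulvirenti, *The Mathematical Theory of Dilute Gases* (1994) §3.2;
elementary analysis otherwise. No named fact is invoked.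
-/

noncomputable section

namespace Summit.AtomisticToContinuum.HydrodynamicLimit.Theorems.ChaosClosesEulerLocalEquilibriumFromDissipation

open scoped BigOperators Topology Classical MeasureTheory ENNReal InnerProductSpace
open Filter Set MeasureTheory Function ProbabilityTheory
open Literature.MathematicalPhysics.KineticTheory
open Literature.Analysis.FluidPDE
open Summit.AtomisticToContinuum.HydrodynamicLimit.Theorems.LocalSecondLawNegative
open Summit.AtomisticToContinuum.HydrodynamicLimit.Theorems.LocalSecondLawLedger
open Summit.AtomisticToContinuum.HydrodynamicLimit.Theorems.LocalSecondLawLedger.L (rhoC_eq_sum)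
open Summit.AtomisticToContinuum.HydrodynamicLimit.Theorems.ChaosClosesEulerMaxwellianMoments

variable {N : ℕ}

/-! ## §1 The velocity mollifier `φ_δ` -/

/-- The velocity mollifier `φ_δ(v) = M_{1,δ²,0}(v)` of the statement. [folklore] -/
def phiD (δ : ℝ) (v : V3) : ℝ := localMaxwellian 1 (δ ^ 2) 0 v

/-- The maximum `(2πδ²)^{-3/2}` of the mollifier. [folklore] -/
def phiMax (δ : ℝ) : ℝ := (2 * Real.pi * δ ^ 2) ^ (-(Module.finrank ℝ V3 : ℝ) / 2)

/-- `φ_δ(v − u)` is the Gaussian density of mean `v` and variance `δ²` at `u`. [folklore] -/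
theorem phiD_eq (δ : ℝ) (v u : V3) : phiD δ (v - u) = localMaxwellian 1 (δ ^ 2) v u := by
  rw [phiD, localMaxwellian, localMaxwellian, sub_zero, norm_sub_rev]

/-- `φ_δ ≥ 0`. [folklore] -/
theorem phiD_nonneg (δ : ℝ) (v : V3) : 0 ≤ phiD δ v := localMaxwellian_nonneg zero_le_one (sq_nonneg δ) 0 v

/-- `phiMax δ ≥ 0`. [folklore] -/
theorem phiMax_nonneg (δ : ℝ) : 0 ≤ phiMax δ := by
  unfold phiMax; exact Real.rpow_nonneg (by positivity) _

/-- `φ_δ ≤ phiMax δ`. [folklore] -/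
theorem phiD_le (δ : ℝ) (v : V3) : phiD δ v ≤ phiMax δ := by
  unfold phiD phiMax localMaxwellian
  rw [one_mul]
  have h1 : Real.exp (-‖v - 0‖ ^ 2 / (2 * δ ^ 2)) ≤ 1 := by
    rw [Real.exp_le_one_iff, neg_div]
    exact neg_nonpos.2 (by positivity)
  exact mul_le_of_le_one_right (Real.rpow_nonneg (by positivity) _) h1

/-- `φ_δ` is continuous. [folklore] -/
theorem continuous_phiD (δ : ℝ) : Continuous (phiD δ) := continuous_localMaxwellian 1 (δ ^ 2) 0

/-- **Gaussian transfer**: `∫ φ_δ(v − u) F(u) du = ∫ F d(gaussMeasure v δ²)` (`δ > 0`). [folklore] -/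
theorem integral_phiD_mul {δ : ℝ} (hδ : 0 < δ) (v : V3) (F : V3 → ℝ) :
    ∫ u, phiD δ (v - u) * F u = ∫ u, F u ∂(gaussMeasure v (δ ^ 2)) := by
  rw [integral_gaussMeasure_eq_integral_mul_localMaxwellian (pow_pos hδ 2) v F]
  refine integral_congr_ae (ae_of_all _ fun u => ?_)
  show phiD δ (v - u) * F u = F u * localMaxwellian 1 (δ ^ 2) v u
  rw [phiD_eq, mul_comm]

/-- Unit mass: `∫ φ_δ(v − u) du = 1`. [folklore] -/
theorem integral_phiD_sub {δ : ℝ} (hδ : 0 < δ) (v : V3) : ∫ u, phiD δ (v - u) = 1 := by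
  have h := integral_phiD_mul hδ v (fun _ => 1)
  simp only [mul_one, integral_const, smul_eq_mul, probReal_univ] at h
  exact h

/-- Second moment: `∫ φ_δ(v − u) ‖u‖² du = ‖v‖² + 3δ²`. [folklore] -/
theorem integral_phiD_mul_norm_sq {δ : ℝ} (hδ : 0 < δ) (v : V3) :
    ∫ u, phiD δ (v - u) * ‖u‖ ^ 2 = ‖v‖ ^ 2 + 3 * δ ^ 2 := by
  rw [integral_phiD_mul hδ, ChaosClosesEulerMaxwellianMoments.integral_norm_sq_gaussMeasure (pow_pos hδ 2) v]

/-! ## §2 The floor `y₀` and the floored logarithm `ℓ_K` -/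

/-- The floor `y₀(v) = e^{−K} (1 + ‖v‖²)⁻²` of the statement. [folklore] -/
def yK (K : ℝ) (v : V3) : ℝ := Real.exp (-K) * ((1 + ‖v‖ ^ 2) ^ 2)⁻¹

/-- The floored logarithm `ℓ_K(v, y)` of the statement (`= log y` above the floor, the tangent line below).
[folklore] -/
def ellK (K : ℝ) (v : V3) (y : ℝ) : ℝ :=
  if yK K v ≤ y then Real.log y else Real.log (yK K v) + (y - yK K v) / yK K v

/-- `y₀ > 0`. [folklore] -/
theorem yK_pos (K : ℝ) (v : V3) : 0 < yK K v := by
  unfold yK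
  exact mul_pos (Real.exp_pos _) (inv_pos.2 (pow_pos (by nlinarith [sq_nonneg ‖v‖]) 2))

/-- `log y₀(v) = −K − 2 log(1 + ‖v‖²)`. [folklore] -/
theorem log_yK (K : ℝ) (v : V3) : Real.log (yK K v) = -K - 2 * Real.log (1 + ‖v‖ ^ 2) := by
  unfold yK
  rw [Real.log_mul (Real.exp_pos _).ne' (by positivity), Real.log_exp, Real.log_inv, Real.log_pow]
  push_cast
  ring

/-- `y₀` is continuous. [folklore] -/
theorem continuous_yK (K : ℝ) : Continuous (yK K) := by
  unfold yK
  have h : Continuous fun v : V3 => (1 + ‖v‖ ^ 2) ^ 2 := by fun_prop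
  exact continuous_const.mul (h.inv₀ fun v => by positivity)

/-- **The floored logarithm as `log (max y y₀) + min 0 ((y − y₀)/y₀)`.** [folklore] -/
theorem ellK_eq (K : ℝ) (v : V3) (y : ℝ) :
    ellK K v y = Real.log (max y (yK K v)) + min 0 ((y - yK K v) / yK K v) := by
  have hy := yK_pos K v
  unfold ellK
  split_ifs with h
  · rw [max_eq_left h, min_eq_left (div_nonneg (sub_nonneg.2 h) hy.le), add_zero]
  · push Not at h
    rw [max_eq_right h.le, min_eq_right (div_nonpos_of_nonpos_of_nonneg (by linarith) hy.le)]

/-- **`ℓ_K` is jointly continuous in `(v, y)`.** [folklore] -/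
theorem continuous_ellK (K : ℝ) : Continuous fun p : V3 × ℝ => ellK K p.1 p.2 := by
  have h : (fun p : V3 × ℝ => ellK K p.1 p.2) =
      fun p => Real.log (max p.2 (yK K p.1)) + min 0 ((p.2 - yK K p.1) / yK K p.1) :=
    funext fun p => ellK_eq K p.1 p.2
  rw [h]
  have hy : Continuous fun p : V3 × ℝ => yK K p.1 := (continuous_yK K).comp continuous_fst
  refine ((continuous_snd.max hy).log fun p => ?_).add
    (continuous_const.min ((continuous_snd.sub hy).div hy fun p => (yK_pos K p.1).ne'))
  exact (lt_of_lt_of_le (yK_pos K p.1) (le_max_right _ _)).ne'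

/-- `log(1 + ‖v‖²) ≤ ‖v‖²`. [folklore] -/
theorem log_one_add_norm_sq_le (v : V3) : Real.log (1 + ‖v‖ ^ 2) ≤ ‖v‖ ^ 2 := by
  have h := Real.log_le_sub_one_of_pos (show 0 < 1 + ‖v‖ ^ 2 by positivity)
  linarith

/-- **The floored logarithm has logarithmic growth**: `|ℓ_K(v, y)| ≤ |K| + 1 + log C + 2 log(1 + ‖v‖²)` for
`0 ≤ y ≤ C`, `1 ≤ C`. [folklore] -/
theorem abs_ellK_le (K : ℝ) (v : V3) {y C : ℝ} (hy0 : 0 ≤ y) (hyC : y ≤ C) (hC : 1 ≤ C) :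
    |ellK K v y| ≤ |K| + 1 + Real.log C + 2 * Real.log (1 + ‖v‖ ^ 2) := by
  have hyk := yK_pos K v
  have hlog1 : 0 ≤ Real.log (1 + ‖v‖ ^ 2) := Real.log_nonneg (by nlinarith [sq_nonneg ‖v‖])
  have hlogC : 0 ≤ Real.log C := Real.log_nonneg hC
  have hK1 := le_abs_self K
  have hK2 := neg_abs_le K
  unfold ellK
  split_ifs with h
  · have hypos : 0 < y := hyk.trans_le h
    have hup : Real.log y ≤ Real.log C := Real.log_le_log hypos hyC
    have hlo : Real.log (yK K v) ≤ Real.log y := Real.log_le_log hyk h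
    rw [log_yK] at hlo
    rw [abs_le]
    constructor <;> linarith
  · push Not at h
    have h1 : -1 ≤ (y - yK K v) / yK K v := by rw [le_div_iff₀ hyk]; linarith
    have h2 : (y - yK K v) / yK K v ≤ 0 := div_nonpos_of_nonpos_of_nonneg (by linarith) hyk.le
    rw [log_yK, abs_le]
    constructor <;> linarith

/-- The quadratic form of the growth bound: `|ℓ_K(v, y)| ≤ |K| + 1 + log C + 2‖v‖²`. [folklore] -/
theorem abs_ellK_le' (K : ℝ) (v : V3) {y C : ℝ} (hy0 : 0 ≤ y) (hyC : y ≤ C) (hC : 1 ≤ C) :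
    |ellK K v y| ≤ |K| + 1 + Real.log C + 2 * ‖v‖ ^ 2 := by
  have h := abs_ellK_le K v hy0 hyC hC
  have h2 := log_one_add_norm_sq_le v
  linarith

/-! ## §3 The mollified cone law `g_x` -/

/-- The `δ`-mollified `x`-cone velocity law `g_x(v) = ∫ b_r(q.1, x) φ_δ(v − q.2) dμ_w` of the statement. [folklore] -/
def gC (r δ : ℝ) (w : Phase N) (x : T3) (v : V3) : ℝ :=
  ∫ q, cone r q.1 x * phiD δ (v - q.2) ∂(empiricalMeasure w)

/-- Particle-sum form of `g_x`. [folklore] -/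
theorem gC_eq_sum (r δ : ℝ) (w : Phase N) (x : T3) (v : V3) :
    gC r δ w x v = ((N + 1 : ℕ) : ℝ)⁻¹ * ∑ i, cone r (w i).1 x * phiD δ (v - (w i).2) := by
  unfold gC; rw [integral_empiricalMeasure]

/-- `g_x ≥ 0`. [folklore] -/
theorem gC_nonneg {r : ℝ} (hr : 0 < r) (δ : ℝ) (w : Phase N) (x : T3) (v : V3) : 0 ≤ gC r δ w x v := by
  rw [gC_eq_sum]
  exact mul_nonneg (by positivity) (Finset.sum_nonneg fun i _ => mul_nonneg (cone_nonneg hr _ _) (phiD_nonneg δ _))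

/-- `g_x(v) ≤ phiMax δ · ρ_r(x)`. [folklore] -/
theorem gC_le {r : ℝ} (hr : 0 < r) (δ : ℝ) (w : Phase N) (x : T3) (v : V3) :
    gC r δ w x v ≤ phiMax δ * rhoC r w x := by
  rw [gC_eq_sum, rhoC_eq_sum, Finset.mul_sum, Finset.mul_sum, Finset.mul_sum]
  refine Finset.sum_le_sum fun i _ => ?_
  have hφ := phiD_le δ (v - (w i).2)
  have hc := cone_nonneg hr (w i).1 x
  calc ((N + 1 : ℕ) : ℝ)⁻¹ * (cone r (w i).1 x * phiD δ (v - (w i).2))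
      ≤ ((N + 1 : ℕ) : ℝ)⁻¹ * (cone r (w i).1 x * phiMax δ) :=
        mul_le_mul_of_nonneg_left (mul_le_mul_of_nonneg_left hφ hc) (by positivity)
    _ = phiMax δ * (((N + 1 : ℕ) : ℝ)⁻¹ * cone r (w i).1 x) := by ring

/-- The cone kernel is jointly continuous. [folklore] -/
theorem continuous_cone_uncurry' (r : ℝ) : Continuous fun p : T3 × T3 => cone r p.1 p.2 := by
  unfold cone
  exact continuous_const.mul ((continuous_const.sub (Torus.continuous_euclidDist.div_const r)).max continuous_const)

/-- **`g` is jointly measurable along measurable data**: for measurable `W : α → Phase N`, `X : α → T3`, the map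
`(a, u) ↦ g_{X a}[W a](u)` is measurable. [folklore] -/
theorem measurable_gC_comp (r δ : ℝ) {α : Type*} [MeasurableSpace α] {W : α → Phase N} {X : α → T3}
    (hW : Measurable W) (hX : Measurable X) :
    Measurable fun p : α × V3 => gC r δ (W p.1) (X p.1) p.2 := by
  have h : (fun p : α × V3 => gC r δ (W p.1) (X p.1) p.2) =
      fun p => ((N + 1 : ℕ) : ℝ)⁻¹ * ∑ i, cone r (W p.1 i).1 (X p.1) * phiD δ (p.2 - (W p.1 i).2) :=
    funext fun p => gC_eq_sum r δ (W p.1) (X p.1) p.2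
  rw [h]
  refine measurable_const.mul (Finset.measurable_sum _ fun i _ => ?_)
  have hi : Measurable fun p : α × V3 => W p.1 i := (measurable_pi_apply i).comp (hW.comp measurable_fst)
  exact ((continuous_cone_uncurry' r).measurable.comp (hi.fst.prodMk (hX.comp measurable_fst))).mul
    ((continuous_phiD δ).measurable.comp (measurable_snd.sub hi.snd))

/-- `u ↦ ℓ_K(u, g_x(u))` is jointly measurable along measurable data. [folklore] -/
theorem measurable_ellK_gC_comp (r δ K : ℝ) {α : Type*} [MeasurableSpace α] {W : α → Phase N} {X : α → T3}
    (hW : Measurable W) (hX : Measurable X) :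
    Measurable fun p : α × V3 => ellK K p.2 (gC r δ (W p.1) (X p.1) p.2) :=
  ((continuous_ellK K).measurable.comp (measurable_snd.prodMk (measurable_gC_comp r δ hW hX)) :)

/-- For one configuration and one centre, `u ↦ ℓ_K(u, g_x(u))` is continuous. [folklore] -/
theorem continuous_ellK_gC (r δ K : ℝ) (w : Phase N) (x : T3) : Continuous fun u : V3 => ellK K u (gC r δ w x u) := by
  have h : (fun u : V3 => gC r δ w x u) = fun u => ((N + 1 : ℕ) : ℝ)⁻¹ * ∑ i, cone r (w i).1 x * phiD δ (u - (w i).2) :=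
    funext fun u => gC_eq_sum r δ w x u
  have hg : Continuous fun u : V3 => gC r δ w x u := by
    rw [h]
    exact continuous_const.mul (continuous_finsetSum _ fun i _ =>
      continuous_const.mul ((continuous_phiD δ).comp (continuous_id.sub continuous_const)))
  exact ((continuous_ellK K).comp (continuous_id.prodMk hg) :)

/-! ## §4 The smoothed floored log-density `Λ̃_x` -/

/-- The doubly mollified floored log-density `Λ̃_x(v) = ∫ φ_δ(v − u) ℓ_K(u, g_x(u)) du` of the statement. [folklore] -/
def LamC (r δ K : ℝ) (w : Phase N) (x : T3) (v : V3) : ℝ :=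
  ∫ u, phiD δ (v - u) * ellK K u (gC r δ w x u)

/-- The log-growth constant `A(K, δ, ρ̄) = |K| + 1 + log(phiMax δ · ρ̄ + 1) + 6δ²` of `Λ̃`. [folklore] -/
def ALam (K δ ρb : ℝ) : ℝ := |K| + 1 + Real.log (phiMax δ * ρb + 1) + 6 * δ ^ 2

/-- `Λ̃_x(v)` is a Gaussian average of `ℓ_K(·, g_x(·))`. [folklore] -/
theorem LamC_eq_gauss {δ : ℝ} (hδ : 0 < δ) (r K : ℝ) (w : Phase N) (x : T3) (v : V3) :
    LamC r δ K w x v = ∫ u, ellK K u (gC r δ w x u) ∂(gaussMeasure v (δ ^ 2)) :=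
  integral_phiD_mul hδ v _

/-- The pointwise growth of the integrand of `Λ̃`: `|ℓ_K(u, g_x(u))| ≤ A − 6δ² + 2‖u‖²` when `ρ_r(x) ≤ ρ̄`. [folklore] -/
theorem abs_ellK_gC_le {r : ℝ} (hr : 0 < r) (δ K : ℝ) (w : Phase N) (x : T3) {ρb : ℝ}
    (hρ : rhoC r w x ≤ ρb) (u : V3) :
    |ellK K u (gC r δ w x u)| ≤ |K| + 1 + Real.log (phiMax δ * ρb + 1) + 2 * ‖u‖ ^ 2 := by
  have h0 := gC_nonneg hr δ w x u
  have hρ0 : 0 ≤ ρb := (rhoC_nonneg hr w x).trans hρ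
  have h1 : gC r δ w x u ≤ phiMax δ * ρb + 1 :=
    ((gC_le hr δ w x u).trans (mul_le_mul_of_nonneg_left hρ (phiMax_nonneg δ))).trans (by linarith)
  have hC : 1 ≤ phiMax δ * ρb + 1 := by nlinarith [phiMax_nonneg δ]
  exact abs_ellK_le' K u h0 h1 hC

/-- The constant part of `A` is nonnegative. [folklore] -/
theorem ALam_nonneg (K δ : ℝ) {ρb : ℝ} (hρb : 0 ≤ ρb) : 0 ≤ ALam K δ ρb := by
  unfold ALam
  have : 0 ≤ Real.log (phiMax δ * ρb + 1) := Real.log_nonneg (by nlinarith [phiMax_nonneg δ])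
  positivity

/-- **LOG GROWTH OF THE ENTROPIC MARK**: `|Λ̃_x(v)| ≤ A(K, δ, ρ̄) + 2‖v‖²` whenever `ρ_r(x) ≤ ρ̄` (`δ > 0`): the
Gaussian average of `|ℓ_K(u, g_x(u))| ≤ A − 6δ² + 2‖u‖²`, `∫ ‖u‖² dN(v, δ²) = ‖v‖² + 3δ²`. [folklore] -/
theorem abs_LamC_le {r : ℝ} (hr : 0 < r) {δ : ℝ} (hδ : 0 < δ) (K : ℝ) (w : Phase N) (x : T3) {ρb : ℝ}
    (hρ : rhoC r w x ≤ ρb) (v : V3) :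
    |LamC r δ K w x v| ≤ ALam K δ ρb + 2 * ‖v‖ ^ 2 := by
  rw [LamC_eq_gauss hδ]
  set A₀ := |K| + 1 + Real.log (phiMax δ * ρb + 1) with hA₀
  have hint2 := Summit.AtomisticToContinuum.HydrodynamicLimit.Theorems.integrable_norm_sq_gaussMeasure v (δ ^ 2)
  have hI : Integrable (fun u : V3 => A₀ + 2 * ‖u‖ ^ 2) (gaussMeasure v (δ ^ 2)) :=
    (integrable_const A₀).add (hint2.const_mul 2)
  calc |∫ u, ellK K u (gC r δ w x u) ∂(gaussMeasure v (δ ^ 2))|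
      ≤ ∫ u, |ellK K u (gC r δ w x u)| ∂(gaussMeasure v (δ ^ 2)) := abs_integral_le_integral_abs
    _ ≤ ∫ u, (A₀ + 2 * ‖u‖ ^ 2) ∂(gaussMeasure v (δ ^ 2)) :=
        integral_mono_of_nonneg (ae_of_all _ fun _ => abs_nonneg _) hI
          (ae_of_all _ fun u => abs_ellK_gC_le hr δ K w x hρ u)
    _ = A₀ + 2 * (‖v‖ ^ 2 + 3 * δ ^ 2) := by
        rw [integral_add (integrable_const A₀) (hint2.const_mul 2), integral_const, smul_eq_mul, probReal_univ,
          one_mul, integral_const_mul, ChaosClosesEulerMaxwellianMoments.integral_norm_sq_gaussMeasure (pow_pos hδ 2) v]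
    _ = ALam K δ ρb + 2 * ‖v‖ ^ 2 := by rw [hA₀, ALam]; ring

/-- On the pair-energy ball: `|Λ̃_x(v)| ≤ A + 2L` for `‖v‖² ≤ L`. [folklore] -/
theorem abs_LamC_le_of_sq_le {r : ℝ} (hr : 0 < r) {δ : ℝ} (hδ : 0 < δ) (K : ℝ) (w : Phase N) (x : T3) {ρb : ℝ}
    (hρ : rhoC r w x ≤ ρb) {L : ℝ} {v : V3} (hv : ‖v‖ ^ 2 ≤ L) :
    |LamC r δ K w x v| ≤ ALam K δ ρb + 2 * L :=
  (abs_LamC_le hr hδ K w x hρ v).trans (by linarith)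

/-- **`Λ̃` is jointly measurable along measurable data**: for measurable `W : α → Phase N`, `X : α → T3`,
`V : α → V3` the map `a ↦ Λ̃_{X a}[W a](V a)` is measurable (a parametric integral of a jointly measurable
integrand). [folklore] -/
theorem measurable_LamC_comp (r δ K : ℝ) {α : Type*} [MeasurableSpace α] {W : α → Phase N} {X : α → T3}
    {V : α → V3} (hW : Measurable W) (hX : Measurable X) (hV : Measurable V) :
    Measurable fun a => LamC r δ K (W a) (X a) (V a) := by
  have hF : Measurable fun q : α × V3 => phiD δ (V q.1 - q.2) * ellK K q.2 (gC r δ (W q.1) (X q.1) q.2) :=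
    ((continuous_phiD δ).measurable.comp ((hV.comp measurable_fst).sub measurable_snd)).mul
      (measurable_ellK_gC_comp r δ K hW hX)
  exact (hF.stronglyMeasurable.integral_prod_right' (ν := (volume : Measure V3))).measurable

/-- For one configuration, `(x, v) ↦ Λ̃_x(v)` is jointly measurable. [folklore] -/
theorem measurable_LamC_xv (r δ K : ℝ) (w : Phase N) : Measurable fun p : T3 × V3 => LamC r δ K w p.1 p.2 :=
  measurable_LamC_comp r δ K measurable_const measurable_fst measurable_snd

/-- For one configuration and one centre, `v ↦ Λ̃_x(v)` is measurable. [folklore] -/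
theorem measurable_LamC_v (r δ K : ℝ) (w : Phase N) (x : T3) : Measurable (LamC r δ K w x) :=
  measurable_LamC_comp r δ K measurable_const measurable_const measurable_id

/-! ## §5 The cut Enskog prediction and the cut dissipation -/

/-- The pair-energy cut `1{‖v‖² + ‖u‖² ≤ L}` of the statement. [folklore] -/
def cutL (L : ℝ) (v u : V3) : ℝ := if ‖v‖ ^ 2 + ‖u‖ ^ 2 ≤ L then 1 else 0

/-- The cut Enskog prediction `𝒫 = ∫∫ cut · (∫ [Λ(v) − Λ(v′)] ((u−v)·ω)₊ dω) · e^{Λ(v)} e^{Λ(u)} dv du` of an abstract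
log-density `Λ` (the `Pred` of `PointwiseEntropicChaos`). [folklore] -/
def predF (L : ℝ) (Λ : V3 → ℝ) : ℝ :=
  ∫ v, ∫ u, cutL L v u * (∫ ω : Metric.sphere (0 : V3) 1,
    (Λ v - Λ (collide ω (v, u)).1) * hardSphereKernel (u, v) ω ∂sphereMeasure) * (Real.exp (Λ v) * Real.exp (Λ u))

/-- The cut dissipation `D = ∫∫ cut · (∫ [Λ(v) + Λ(u) − Λ(v′) − Λ(u′)] ((u−v)·ω)₊ dω) · e^{Λ(v)} e^{Λ(u)} dv du` of an
abstract log-density `Λ` (the `D` of `DissipationRigidity`). [folklore] -/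
def dissF (L : ℝ) (Λ : V3 → ℝ) : ℝ :=
  ∫ v, ∫ u, cutL L v u * (∫ ω : Metric.sphere (0 : V3) 1,
    (Λ v + Λ u - Λ (collide ω (v, u)).1 - Λ (collide ω (v, u)).2) * hardSphereKernel (u, v) ω ∂sphereMeasure) *
      (Real.exp (Λ v) * Real.exp (Λ u))

/-- The cut Enskog prediction `𝒫(w, x)` of the statement, on the smoothed cone law. [folklore] -/
def PredC (r δ K L : ℝ) (w : Phase N) (x : T3) : ℝ := predF L (LamC r δ K w x)

/-- The cut dissipation `D(G̃_{x}[w])` of `DissipationRigidity`, on the smoothed cone law. [folklore] -/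
def DissC (r δ K L : ℝ) (w : Phase N) (x : T3) : ℝ := dissF L (LamC r δ K w x)

/-- `0 ≤ cut ≤ 1`. [folklore] -/
theorem cutL_nonneg_le (L : ℝ) (v u : V3) : 0 ≤ cutL L v u ∧ cutL L v u ≤ 1 := by
  unfold cutL; split_ifs <;> norm_num

/-- The cut is symmetric. [folklore] -/
theorem cutL_comm (L : ℝ) (v u : V3) : cutL L u v = cutL L v u := by
  unfold cutL; rw [add_comm]

/-- Where the cut does not vanish both velocities lie in the pair-energy ball. [folklore] -/
theorem sq_le_of_cutL_ne_zero {L : ℝ} {v u : V3} (h : cutL L v u ≠ 0) : ‖v‖ ^ 2 ≤ L ∧ ‖u‖ ^ 2 ≤ L := by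
  unfold cutL at h
  split_ifs at h with hc
  · exact ⟨by nlinarith [sq_nonneg ‖u‖], by nlinarith [sq_nonneg ‖v‖]⟩
  · exact absurd rfl h

/-- The cut is invariant under the collision (conservation of the pair energy). [folklore] -/
theorem cutL_collide (L : ℝ) (ω : Metric.sphere (0 : V3) 1) (v u : V3) :
    cutL L (collide ω (v, u)).1 (collide ω (v, u)).2 = cutL L v u := by
  unfold cutL; rw [norm_sq_collide_fst_add_norm_sq_collide_snd]

/-! ## §6 Registered sub-goal -/

/-- **Registered sub-goal `stub_localEquilibriumFromDissipationA` (helper A of `stub_localEquilibriumFromDissipation`):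
the floored logarithm has logarithmic growth** — `|ℓ_K(v, y)| ≤ |K| + 1 + log C + 2 log(1 + ‖v‖²)` for `0 ≤ y ≤ C`,
`1 ≤ C`. [folklore] -/
theorem stub_localEquilibriumFromDissipationA : ∀ (K : ℝ) (v : V3) (y C : ℝ), 0 ≤ y → y ≤ C → 1 ≤ C → |(if Real.exp (-K) * ((1 + ‖v‖ ^ 2) ^ 2)⁻¹ ≤ y then Real.log y else Real.log (Real.exp (-K) * ((1 + ‖v‖ ^ 2) ^ 2)⁻¹) + (y - Real.exp (-K) * ((1 + ‖v‖ ^ 2) ^ 2)⁻¹) / (Real.exp (-K) * ((1 + ‖v‖ ^ 2) ^ 2)⁻¹))| ≤ |K| + 1 + Real.log C + 2 * Real.log (1 + ‖v‖ ^ 2) :=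
  fun K v _ _ hy0 hyC hC => abs_ellK_le K v hy0 hyC hC

end Summit.AtomisticToContinuum.HydrodynamicLimit.Theorems.ChaosClosesEulerLocalEquilibriumFromDissipation

end
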